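import Mathlib
import Summits.Ventures.PercRepro2.Defs
import Summits.Ventures.PercRepro2.Graph
import Summits.Ventures.PercRepro2.Induced
import Summits.Ventures.PercRepro2.VdBKahn
import Summits.Ventures.PercRepro2.ReimerVdBK
import Summits.Ventures.PercRepro2.ReimerVdBKRegions

/-!
# Closing the edges at an unreached vertex: the two-world event with `z` in neither world
(blind cell PercRepro2, mine-c g45; `conjectures/MINE-C.md` §54.6 — the Z-reduction, part 1)

For a vertex `z` write `closeAt z ω` for `ω` with every edge at `z` closed.  (1) If the root does not reach
`z` in `ω`, closing the edges at `z` changes no connection (`conn_closeAt_iff`): the world of `G − z` is the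
world of `closeAt z ω`.  (2) The root reaches `z` iff some edge at `z` is open towards a reached vertex:
`z ∉ K₁` iff every open edge `{z, y}` has `y` unreached in `closeAt z ω` (`not_conn_iff_pointingAway`), and
the same in world 2 with `compl`.  Hence, for an instance in which `z` is unmarked, the two-world event of
`(A, X ∪ {z}; B, Y ∪ {z})` is the two-world event of `(A, X; B, Y)` evaluated on the reduced configurations
(`delTwoWorld`) together with «every edge at `z` points away from the world it is open in» (`zAway`):
`mem_twoWorld_insert_iff_del`.  Part 2 (`ReimerVdBKZReduction`) sums the second factor over the colours
of the edges at `z`.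
-/

namespace Summit.Ventures.PercRepro2

namespace ReimerVdBK

open Classical

variable {V : Type*} {E : Type*} [Fintype E] [DecidableEq E] [Fintype V] [DecidableEq V]

variable (ends : E → Sym2 V)

/-! ## Closing the edges at a vertex -/

/-- `ω` with every edge at `z` closed (world 1 does not see `z`). -/
def closeAt (z : V) (ω : Config E) : Config E := fun e => if z ∈ ends e then false else ω e

omit [Fintype E] [DecidableEq E] [Fintype V] in
/-- An edge at `z` is closed in `closeAt z ω`. -/
lemma closeAt_apply_of_mem {z : V} {ω : Config E} {e : E} (h : z ∈ ends e) :
    closeAt ends z ω e = false := by simp [closeAt, h]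

omit [Fintype E] [DecidableEq E] [Fintype V] in
/-- An edge not at `z` keeps its colour in `closeAt z ω`. -/
lemma closeAt_apply_of_notMem {z : V} {ω : Config E} {e : E} (h : z ∉ ends e) :
    closeAt ends z ω e = ω e := by simp [closeAt, h]

omit [Fintype E] [DecidableEq E] [Fintype V] in
/-- Closing edges only decreases the configuration. -/
lemma closeAt_le (z : V) (ω : Config E) : closeAt ends z ω ≤ ω := by
  intro e
  by_cases h : z ∈ ends e
  · rw [closeAt_apply_of_mem ends h]; exact Bool.false_le _
  · rw [closeAt_apply_of_notMem ends h]

omit [Fintype E] [Fintype V] in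
/-- `closeAt` ignores the colours of the edges at `z`: updating such an edge does not change it. -/
lemma closeAt_update {z : V} (ω : Config E) {f : E} (hf : z ∈ ends f) (b : Bool) :
    closeAt ends z (Function.update ω f b) = closeAt ends z ω := by
  funext e
  by_cases he : z ∈ ends e
  · rw [closeAt_apply_of_mem ends he, closeAt_apply_of_mem ends he]
  · have hef : e ≠ f := fun h => he (h ▸ hf)
    rw [closeAt_apply_of_notMem ends he, closeAt_apply_of_notMem ends he, Function.update_of_ne hef]

omit [Fintype E] [Fintype V] [DecidableEq V] in
/-- The complement of an update is the update of the complement by the negated bit. -/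
lemma compl_update_eq (ω : Config E) (f : E) (b : Bool) :
    compl (Function.update ω f b) = Function.update (compl ω) f (!b) := by
  funext e
  by_cases h : e = f
  · subst h; simp [compl]
  · simp [compl, Function.update_of_ne h]

omit [Fintype E] [Fintype V] in
/-- `closeAt z (compl ω)` is blind to the edges at `z` as well. -/
lemma closeAt_compl_update {z : V} (ω : Config E) {f : E} (hf : z ∈ ends f) (b : Bool) :
    closeAt ends z (compl (Function.update ω f b)) = closeAt ends z (compl ω) := by
  rw [compl_update_eq, closeAt_update ends _ hf]

variable (s : V)

omit [Fintype E] [DecidableEq E] [Fintype V] in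
/-- In `closeAt z ω` the vertex `z` is isolated: the root `s ≠ z` does not reach it. -/
lemma not_conn_closeAt_self {z : V} (ω : Config E) (hsz : s ≠ z) : ¬ Conn ends (closeAt ends z ω) s z := by
  intro h
  let S : Set V := {x | x ≠ z}
  have hS : ∀ x ∈ S, ∀ y, (openGraph ends (closeAt ends z ω)).Adj x y → y ∈ S := by
    intro x hx y hxy hyz
    subst hyz
    obtain ⟨_, e, he, hends⟩ := openGraph_adj.1 hxy
    have hz : y ∈ ends e := by rw [hends]; exact Sym2.mem_mk_right x y
    rw [closeAt_apply_of_mem ends hz] at he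
    exact absurd he Bool.false_ne_true
  exact mem_of_conn_of_closed hS hsz h rfl

omit [Fintype E] [DecidableEq E] [Fintype V] in
/-- **Closing the edges at an unreached vertex changes nothing**: if `s` does not reach `z` in `ω`, then
`s ↔ v` in `ω` iff `s ↔ v` in `closeAt z ω`. -/
theorem conn_closeAt_iff {z : V} {ω : Config E} (hz : ¬ Conn ends ω s z) (v : V) :
    Conn ends ω s v ↔ Conn ends (closeAt ends z ω) s v := by
  constructor
  · intro h
    let S : Set V := {x | Conn ends (closeAt ends z ω) s x}
    have hS : ∀ x ∈ S, ∀ y, (openGraph ends ω).Adj x y → y ∈ S := by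
      intro x hx y hxy
      obtain ⟨_, e, he, hends⟩ := openGraph_adj.1 hxy
      have hxz : x ≠ z := fun h => hz (h ▸ conn_mono (closeAt_le ends z ω) hx)
      have hyz : y ≠ z := by
        intro hyz
        have hy : Conn ends ω s y :=
          conn_trans (conn_mono (closeAt_le ends z ω) hx) (conn_of_openAdj ⟨e, he, hends⟩)
        exact hz (hyz ▸ hy)
      have hze : z ∉ ends e := by
        intro hze
        rw [hends, Sym2.mem_iff] at hze
        rcases hze with h | h
        · exact hxz h.symm
        · exact hyz h.symm
      have he' : closeAt ends z ω e = true := by rw [closeAt_apply_of_notMem ends hze]; exact he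
      exact conn_trans hx (conn_of_openAdj ⟨e, he', hends⟩)
    exact mem_of_conn_of_closed hS (conn_refl ends _ s) h
  · exact conn_mono (closeAt_le ends z ω)

/-- «Every edge at `z` points away from the world it is open in»: an open edge `{z, y}` has `y` unreached in
`closeAt z ω` (world 1 without `z`), a closed one has `y` unreached in `closeAt z (compl ω)` (world 2
without `z`). -/
def zAway (z : V) (ω : Config E) : Prop :=
  ∀ e, ∀ y, ends e = s(z, y) →
    (ω e = true → ¬ Conn ends (closeAt ends z ω) s y) ∧
    (ω e = false → ¬ Conn ends (closeAt ends z (compl ω)) s y)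

omit [Fintype E] [DecidableEq E] [Fintype V] in
/-- **The root does not reach `z` iff every open edge at `z` points away**, in world 1. -/
theorem not_conn_iff_pointingAway {z : V} (ω : Config E) (hsz : s ≠ z) :
    ¬ Conn ends ω s z ↔
      ∀ e, ∀ y, ends e = s(z, y) → ω e = true → ¬ Conn ends (closeAt ends z ω) s y := by
  constructor
  · intro hz e y hends he hy
    apply hz
    have hy' : Conn ends ω s y := conn_mono (closeAt_le ends z ω) hy
    exact conn_trans hy' (conn_of_openAdj ⟨e, he, by rw [hends, Sym2.eq_swap]⟩)
  · intro hpt h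
    let S : Set V := {x | x ≠ z ∧ Conn ends (closeAt ends z ω) s x}
    have hS : ∀ x ∈ S, ∀ y, (openGraph ends ω).Adj x y → y ∈ S := by
      intro x hx y hxy
      obtain ⟨hxz, hxc⟩ := hx
      obtain ⟨_, e, he, hends⟩ := openGraph_adj.1 hxy
      by_cases hyz : y = z
      · subst hyz
        exact absurd hxc (hpt e x (by rw [hends, Sym2.eq_swap]) he)
      · have hze : z ∉ ends e := by
          intro hze
          rw [hends, Sym2.mem_iff] at hze
          rcases hze with h' | h'
          · exact hxz h'.symm
          · exact hyz h'.symm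
        have he' : closeAt ends z ω e = true := by rw [closeAt_apply_of_notMem ends hze]; exact he
        exact ⟨hyz, conn_trans hxc (conn_of_openAdj ⟨e, he', hends⟩)⟩
    have := mem_of_conn_of_closed hS ⟨hsz, conn_refl ends _ s⟩ h
    exact this.1 rfl

omit [Fintype E] [DecidableEq E] [Fintype V] in
/-- `z` in neither world iff every edge at `z` points away (`zAway`). -/
theorem neither_iff_zAway {z : V} (ω : Config E) (hsz : s ≠ z) :
    (¬ Conn ends ω s z ∧ ¬ Conn ends (compl ω) s z) ↔ zAway ends s z ω := by
  rw [not_conn_iff_pointingAway ends s ω hsz, not_conn_iff_pointingAway ends s (compl ω) hsz]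
  unfold zAway
  constructor
  · rintro ⟨h1, h2⟩ e y hends
    refine ⟨h1 e y hends, fun he => h2 e y hends ?_⟩
    simp [compl, he]
  · intro h
    refine ⟨fun e y hends he => (h e y hends).1 he, fun e y hends he => (h e y hends).2 ?_⟩
    simpa [compl] using he

/-! ## The reduced two-world event -/

/-- The two-world event of `(A, X; B, Y)` evaluated on the reduced configurations: world 1 is
`closeAt z ω`, world 2 is `closeAt z (compl ω)` — the worlds of `G − z`. -/
def delTwoWorld (z : V) (A X B Y : Finset V) : Set (Config E) :=
  {ω | (∀ a ∈ A, Conn ends (closeAt ends z ω) s a) ∧ (∀ x ∈ X, ¬ Conn ends (closeAt ends z ω) s x) ∧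
    (∀ b ∈ B, Conn ends (closeAt ends z (compl ω)) s b) ∧
    (∀ y ∈ Y, ¬ Conn ends (closeAt ends z (compl ω)) s y)}

omit [Fintype E] [Fintype V] in
/-- The reduced event is blind to the colours of the edges at `z`. -/
lemma mem_delTwoWorld_update_iff {z : V} (A X B Y : Finset V) (ω : Config E) {f : E}
    (hf : z ∈ ends f) (b : Bool) :
    Function.update ω f b ∈ delTwoWorld ends s z A X B Y ↔ ω ∈ delTwoWorld ends s z A X B Y := by
  simp only [delTwoWorld, Set.mem_setOf_eq, closeAt_update ends ω hf b, closeAt_compl_update ends ω hf b]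

omit [Fintype E] [DecidableEq E] [Fintype V] in
/-- **The two-world event with `z` added to `X ∩ Y`** is the reduced event together with `zAway`, when
`z` is unmarked and `s ≠ z`. -/
theorem mem_twoWorld_insert_iff_del {z : V} {A X B Y : Finset V} (hz : z ∉ A ∪ X ∪ B ∪ Y)
    (hsz : s ≠ z) (ω : Config E) :
    ω ∈ twoWorld ends s A (insert z X) B (insert z Y) ↔
      ω ∈ delTwoWorld ends s z A X B Y ∧ zAway ends s z ω := by
  have hA : z ∉ A := fun h => hz (by simp [h])
  have hX : z ∉ X := fun h => hz (by simp [h])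
  have hB : z ∉ B := fun h => hz (by simp [h])
  have hY : z ∉ Y := fun h => hz (by simp [h])
  rw [← neither_iff_zAway ends s ω hsz]
  simp only [twoWorld, connAll, avoidAll, Set.mem_inter_iff, Set.mem_setOf_eq, mem_bar,
    Finset.mem_insert, forall_eq_or_imp, delTwoWorld]
  constructor
  · rintro ⟨⟨ha, hz1, hx⟩, hb, hz2, hy⟩
    refine ⟨⟨fun a hav => (conn_closeAt_iff ends s hz1 a).1 (ha a hav),
      fun x hxv hc => hx x hxv ((conn_closeAt_iff ends s hz1 x).2 hc),
      fun b hbv => (conn_closeAt_iff ends s hz2 b).1 (hb b hbv),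
      fun y hyv hc => hy y hyv ((conn_closeAt_iff ends s hz2 y).2 hc)⟩, hz1, hz2⟩
  · rintro ⟨⟨ha, hx, hb, hy⟩, hz1, hz2⟩
    exact ⟨⟨fun a hav => (conn_closeAt_iff ends s hz1 a).2 (ha a hav), hz1,
      fun x hxv hc => hx x hxv ((conn_closeAt_iff ends s hz1 x).1 hc)⟩,
      fun b hbv => (conn_closeAt_iff ends s hz2 b).2 (hb b hbv), hz2,
      fun y hyv hc => hy y hyv ((conn_closeAt_iff ends s hz2 y).1 hc)⟩

end ReimerVdBK

end Summit.Ventures.PercRepro2
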